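import Summits.ResolutionOfSingularities.ResolutionOfSingularities.Theorems.FrobeniusClosingPatchingRelPerfectDepthSNCPointwise
import HarnessLib

/-!
# Crux `PatchingRelPerfect` (stmt-ResolutionOfSingularities-16161), chain W5.2 — rung R4ˢ-general, END-SNC support:
# simple normal crossings at a point — TRANSPORT through a blow-up (over the centre, and off it with a second centre)

[OURS · L1 W5.2 · rung tool] Replaces the role of NO printed item; NOT a statement of the manuscript under review;
fact-free, any dimension. The END phase of the mixed engine (res-L1-w52-plan-1 F5 DESIGN MEMO dbeef0c69494cc5e, T5-H
`EndSNCTwo`) needs simple normal crossings of the X-side family `[𝓐'] ++ 𝒢' ++ [𝓘_{E'}]` only NEAR THE COSUPPORT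
of the residual `K'` — the host `𝓐'` is singular far from `E'` — so the global predicate `HasSNCWith`
(`Literature/…/MarkedIdeals.lean`) and its transport `HasSNCWith.hasSNC_transform` (`…/BlowupSNC.lean`, Kollár Def. 3.25)
must be localised AT A POINT. This file does exactly that, re-using the chart machinery of `BlowupSNC.lean`
(`ChartData`, whose constructor `exists_chartData` reads the global hypothesis only at the image point):

* (companion file `…DepthSNCPointwise.lean`: `SNCWithAt E C x`, the body of `HasSNCWith E C` at `x`, its API,
  and `exists_chartData_of_sncWithAt`.)
* **`IsBlowup.sncWithAt_transform_of_mem_support`** — over the centre: `SNCWithAt E C (π x')` ⇒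
  `SNCWithAt (E.map (strictTransformIdeal π C) ++ [C.comap π]) ⊤ x'` (Kollár Def. 3.25 at one point).
* **`IsBlowup.sncWithAt_transform_of_not_mem_support`** — off the centre, with a second centre `C₂`:
  `SNCWithAt E C₂ (π x')` ⇒ `SNCWithAt (E.map (strictTransformIdeal π C) ++ [C.comap π]) (C₂.comap π) x'`
  (the blow-up is a local isomorphism there; verbatim `HasSNCWith.transform_comap_of_disjoint`, second half).
* Corollaries: `IsBlowup.sncWithAt_transform` (both cases, centre-free conclusion), the tree's global theorem
  re-derived (`hasSNC_transform_of_forall_sncWithAt`), the set form `IsBlowup.sncWithAt_transform_of_mem_preimage`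
  and the «frozen points» form `IsBlowup.sncWithAt_transform_of_disjoint`.

USE (W5.2): res-D-pv-052's E′-locus half of END-SNC produces `SNCWithAt` at the points of `i(E)` by the retraction
lift; this file carries it (a) to every point of the blow-up over a deficient centre — the new carrier with its
POCKETS — and (b) unchanged through all later blow-ups at points off their centres (res-D-pv-009's off-`E′` half).

## References
* J. Kollár, *Lectures on Resolution of Singularities* (2007), Def. 3.24, Def. 3.25. [Kollar2007]
* E. Bierstone, D. Grigoriev, P. Milman, J. Włodarczyk, arXiv:1206.3090, Def. 3.1.1, Def. 3.1.3 (2), (4).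
  [BierstoneGrigorievMilmanWlodarczyk2011]
* The Stacks Project, Tags 0804, 02OS. [StacksProject]
-/

-- `Summit.<Summit>.<Sub>.Theorems` with `Sub = Summit` (single-conjunct summit, D-0017)
set_option linter.dupNamespace false

noncomputable section

open CategoryTheory CategoryTheory.Limits AlgebraicGeometry TopologicalSpace IsLocalRing
open Literature.AlgebraicGeometry.Resolution

namespace Summit.ResolutionOfSingularities.ResolutionOfSingularities.Theorems

universe u

namespace DepthSNC

variable {X : Scheme.{u}}

/-! ## §1 Transport through a blow-up: points over the centre -/

/-- **Simple normal crossings at a point of the blow-up OVER the centre** (Kollár Def. 3.25 at one point): if `π` is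
a blow-up of the locally Noetherian `X` along `C`, `x'` lies over `V(C)` and `E` has simple normal crossings with `C`
AT `π x'`, then the transformed family — strict transforms of the members of `E`, then the exceptional ideal — has
simple normal crossings at `x'` (verbatim the tree's `exists_snc_labels_of_mem_support`, fed by
`exists_chartData_of_sncWithAt`). [cite: Kollar2007, Def. 3.25] [cite: BierstoneGrigorievMilmanWlodarczyk2011, Def. 3.1.3 (2), (4)] -/
theorem _root_.Literature.AlgebraicGeometry.Resolution.IsBlowup.sncWithAt_transform_of_mem_support
    [IsLocallyNoetherian X] {X' : Scheme.{u}} {π : X' ⟶ X} {C : X.IdealSheafData} (hπ : IsBlowup π C)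
    {E : List X.IdealSheafData} (x' : X') (hE : SNCWithAt E C (π x')) (hxC : π x' ∈ C.support) :
    SNCWithAt (E.map (strictTransformIdeal π C) ++ [C.comap π]) ⊤ x' := by
  classical
  haveI : IsProper π := hπ.isProper
  haveI : IsLocallyNoetherian X' := LocallyOfFiniteType.isLocallyNoetherian π
  obtain ⟨Dc, τ, hτinj, hτ⟩ := exists_chartData_of_sncWithAt hπ x' hE hxC
  obtain ⟨hregS, d, v, hsf, hspan, lab, hlabinj, hv0, hvw, hve⟩ := Dc.exists_rsop hxC
  letI := Dc.algB
  -- the preimage divisor of a non-exceptional member, and its `τ`-label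
  have hpre := fun (D' : {D : X'.IdealSheafData //
      D ∈ E.map (strictTransformIdeal π C) ++ [C.comap π] ∧ x' ∈ D.support}) (hne : D'.1 ≠ C.comap π) =>
    exists_preimage_divisor D' hne
  -- stalks of strict transforms, by cases on the label
  have hstalk_inl : ∀ (K : {K : X.IdealSheafData // K ∈ E ∧ π x' ∈ K.support}) (j : Fin Dc.r),
      τ K = Sum.inl j → j ≠ Dc.i →
      stalkIdeal (strictTransformIdeal π C K.1) x' = Ideal.span {Dc.toStalk (Dc.gen j)} := by
    intro K j hKj hji
    refine Dc.stalkIdeal_strictTransform_x hxC K.1 hji ?_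
    rw [hτ K, hKj, Sum.elim_inl]
  have hstalk_inl_self : ∀ (K : {K : X.IdealSheafData // K ∈ E ∧ π x' ∈ K.support}),
      τ K = Sum.inl Dc.i → stalkIdeal (strictTransformIdeal π C K.1) x' = ⊤ := by
    intro K hKj
    refine Dc.stalkIdeal_strictTransform_x_self hxC K.1 ?_
    rw [hτ K, hKj, Sum.elim_inl]
  have hstalk_inr : ∀ (K : {K : X.IdealSheafData // K ∈ E ∧ π x' ∈ K.support}) (m : Fin Dc.a),
      τ K = Sum.inr m →
      stalkIdeal (strictTransformIdeal π C K.1) x' =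
        Ideal.span {Dc.toStalk (reesChartBase (Dc.x Dc.i)
          (Ideal.mem_span_range_self (f := Dc.x) (x := Dc.i)) (Dc.w m))} := by
    intro K m hKm
    refine Dc.stalkIdeal_strictTransform_w hxC K.1 m ?_
    rw [hτ K, hKm, Sum.elim_inr]
  -- for a strict transform through `x'` with label `inl j`: `j ≠ i` and `e_j ∈ Q`
  have hinl : ∀ (K : {K : X.IdealSheafData // K ∈ E ∧ π x' ∈ K.support}) (j : Fin Dc.r),
      τ K = Sum.inl j → x' ∈ (strictTransformIdeal π C K.1).support → j ≠ Dc.i ∧ Dc.gen j ∈ Dc.Q := by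
    intro K j hKj hx'
    have hle := (mem_support_iff_stalkIdeal_le _ _).mp hx'
    have hji : j ≠ Dc.i := by
      rintro rfl
      rw [hstalk_inl_self K hKj, top_le_iff] at hle
      exact (maximalIdeal.isMaximal _).ne_top hle
    refine ⟨hji, (Dc.chartGen_mem_Q_iff j).mpr ?_⟩
    rw [hstalk_inl K j hKj hji, Ideal.span_singleton_le_iff_mem] at hle
    exact hle
  -- the partial labelling of the values of `τ`
  let g : Fin Dc.r ⊕ Fin Dc.a → Option (Fin Dc.a ⊕ Dc.GoodGen) :=
    Sum.elim (fun j => if h : j ≠ Dc.i ∧ Dc.gen j ∈ Dc.Q then some (Sum.inr ⟨j, h⟩) else none)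
      (fun m => some (Sum.inl m))
  have hg_inl : ∀ (j : Fin Dc.r) (h : j ≠ Dc.i ∧ Dc.gen j ∈ Dc.Q), g (Sum.inl j) = some (Sum.inr ⟨j, h⟩) :=
    fun j h => by simp only [g, Sum.elim_inl, dif_pos h]
  have hg_inr : ∀ m : Fin Dc.a, g (Sum.inr m) = some (Sum.inl m) := fun m => rfl
  have hg_inj : ∀ y₁ y₂, g y₁ = g y₂ → g y₁ ≠ none → y₁ = y₂ := by
    rintro (j₁ | m₁) (j₂ | m₂) h hn
    · simp only [g, Sum.elim_inl] at h hn
      by_cases h₁ : j₁ ≠ Dc.i ∧ Dc.gen j₁ ∈ Dc.Q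
      · rw [dif_pos h₁] at h
        by_cases h₂ : j₂ ≠ Dc.i ∧ Dc.gen j₂ ∈ Dc.Q
        · rw [dif_pos h₂] at h
          simp only [Option.some.injEq, Sum.inr.injEq, Subtype.mk.injEq] at h
          rw [h]
        · rw [dif_neg h₂] at h
          exact absurd h (Option.some_ne_none _)
      · rw [dif_neg h₁] at hn
        exact absurd rfl hn
    · simp only [g, Sum.elim_inl, Sum.elim_inr] at h
      by_cases h₁ : j₁ ≠ Dc.i ∧ Dc.gen j₁ ∈ Dc.Q
      · rw [dif_pos h₁] at h
        simp at h
      · rw [dif_neg h₁] at h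
        exact absurd h.symm (Option.some_ne_none _)
    · simp only [g, Sum.elim_inl, Sum.elim_inr] at h
      by_cases h₂ : j₂ ≠ Dc.i ∧ Dc.gen j₂ ∈ Dc.Q
      · rw [dif_pos h₂] at h
        simp at h
      · rw [dif_neg h₂] at h
        exact absurd h (Option.some_ne_none _)
    · simp only [g, Sum.elim_inr, Option.some.injEq, Sum.inl.injEq] at h
      rw [h]
  -- the key of a member of the transformed boundary through `x'`
  let key : {D : X'.IdealSheafData //
      D ∈ E.map (strictTransformIdeal π C) ++ [C.comap π] ∧ x' ∈ D.support} →
      Option (Fin Dc.a ⊕ Dc.GoodGen) :=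
    fun D' => if hne : D'.1 = C.comap π then none else g (τ (hpre D' hne).choose)
  have hkey_exc : ∀ D' (hne : D'.1 = C.comap π), key D' = none := fun D' hne => by
    simp only [key, dif_pos hne]
  have hkey_ne : ∀ D' (hne : D'.1 ≠ C.comap π), key D' = g (τ (hpre D' hne).choose) := fun D' hne => by
    simp only [key, dif_neg hne]
  have hkey_ne_none : ∀ D' (hne : D'.1 ≠ C.comap π), key D' ≠ none := by
    intro D' hne
    rw [hkey_ne D' hne]
    have hx'K : x' ∈ (strictTransformIdeal π C (hpre D' hne).choose.1).support := by
      rw [(hpre D' hne).choose_spec]; exact D'.2.2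
    rcases hτK : τ (hpre D' hne).choose with j | m
    · rw [hg_inl j (hinl _ j hτK hx'K)]
      exact Option.some_ne_none _
    · rw [hg_inr]
      exact Option.some_ne_none _
  -- the value of the key generates the stalk
  have hkey_stalk : ∀ D', stalkIdeal D'.1 x' = Ideal.span {v (lab (key D'))} := by
    intro D'
    by_cases hne : D'.1 = C.comap π
    · rw [hkey_exc D' hne, hv0, hne]
      exact Dc.stalkIdeal_exceptional hxC
    · have hD : stalkIdeal D'.1 x' = stalkIdeal (strictTransformIdeal π C (hpre D' hne).choose.1) x' := by
        rw [(hpre D' hne).choose_spec]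
      have hx'K : x' ∈ (strictTransformIdeal π C (hpre D' hne).choose.1).support := by
        rw [(hpre D' hne).choose_spec]; exact D'.2.2
      rw [hkey_ne D' hne, hD]
      rcases hτK : τ (hpre D' hne).choose with j | m
      · obtain ⟨hji, hQ⟩ := hinl _ j hτK hx'K
        rw [hg_inl j ⟨hji, hQ⟩, hve]
        exact hstalk_inl _ j hτK hji
      · rw [hg_inr, hvw]
        exact hstalk_inr _ m hτK
  -- the key is injective
  have hkey_inj : Function.Injective key := by
    intro D₁ D₂ h
    by_cases h₁ : D₁.1 = C.comap π
    · by_cases h₂ : D₂.1 = C.comap π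
      · exact Subtype.ext (h₁.trans h₂.symm)
      · exact absurd ((hkey_exc D₁ h₁).symm.trans h) (hkey_ne_none D₂ h₂).symm
    · by_cases h₂ : D₂.1 = C.comap π
      · exact absurd (h.trans (hkey_exc D₂ h₂)) (hkey_ne_none D₁ h₁)
      · have hn := hkey_ne_none D₁ h₁
        rw [hkey_ne D₁ h₁] at h hn
        rw [hkey_ne D₂ h₂] at h
        have hτeq := hg_inj _ _ h hn
        have hpre_eq := hτinj hτeq
        apply Subtype.ext
        rw [← (hpre D₁ h₁).choose_spec, ← (hpre D₂ h₂).choose_spec, hpre_eq]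
  refine ⟨hregS, d, v, hsf, hspan, ⟨fun D' => lab (key D'), hlabinj.comp hkey_inj, hkey_stalk⟩, fun hx => ?_⟩
  rw [Scheme.IdealSheafData.support_top] at hx
  exact absurd hx id

/-! ## §2 Transport through a blow-up: points off the centre (with a second centre) -/

/-- **Simple normal crossings at a point of the blow-up OFF the centre, with a second centre**: if `π` is a blow-up
of `X` along `C` (both schemes locally Noetherian), `x'` lies off `V(C)` and `E` has simple normal crossings with
a second centre `C₂` AT `π x'`, then the transformed family has simple normal crossings with `π^*C₂` at `x'` — the
stalk map `𝒪_{X, π x'} → 𝒪_{X', x'}` is an isomorphism (`IsBlowup.isIso_stalkMap_of_not_mem_support`), the members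
through `x'` are strict transforms = pull-backs of members through `π x'`, and an adapted regular system of
parameters transports (verbatim the second half of the tree's `HasSNCWith.transform_comap_of_disjoint`).
[cite: Kollar2007, Def. 3.25] [cite: StacksProject, Tag 02OS] -/
theorem _root_.Literature.AlgebraicGeometry.Resolution.IsBlowup.sncWithAt_transform_of_not_mem_support
    [IsLocallyNoetherian X] {X' : Scheme.{u}} [IsLocallyNoetherian X'] {π : X' ⟶ X} {C : X.IdealSheafData}
    (hπ : IsBlowup π C) {E : List X.IdealSheafData} {C₂ : X.IdealSheafData} (x' : X')
    (hE : SNCWithAt E C₂ (π x')) (hxC : π x' ∉ C.support) :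
    SNCWithAt (E.map (strictTransformIdeal π C) ++ [C.comap π]) (C₂.comap π) x' := by
  classical
  haveI := hπ.isIso_stalkMap_of_not_mem_support hxC
  let e : X.presheaf.stalk (π x') ≃+* X'.presheaf.stalk x' := (asIso (π.stalkMap x')).commRingCatIsoToRingEquiv
  have he : (e : X.presheaf.stalk (π x') →+* X'.presheaf.stalk x') = (π.stalkMap x').hom := rfl
  obtain ⟨hreg, d, u, hd, hu, ⟨ι, hι, hιD⟩, hC⟩ := hE
  haveI := hreg
  haveI hreg' : IsRegularLocalRing (X'.presheaf.stalk x') := IsRegularLocalRing.of_ringEquiv e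
  refine ⟨hreg', d, fun i => e (u i), ?_, ?_, ?_, ?_⟩
  · -- the embedding dimensions agree
    rw [← map_ringEquiv_maximalIdeal e, Ideal.spanFinrank_map_eq_of_ringEquiv, hd]
  · -- `(u') = 𝔪_{x'}`
    have hr : Set.range (fun i => e (u i)) = e '' Set.range u := (Set.range_comp _ u)
    rw [hr, ← Ideal.map_span e, hu, map_ringEquiv_maximalIdeal]
  · -- the members of the transformed boundary through `x'` are strict transforms of members of `E` through `π x'`
    have key : ∀ D' : {D' // D' ∈ E.map (strictTransformIdeal π C) ++ [C.comap π] ∧ x' ∈ D'.support},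
        ∃ D : {D // D ∈ E ∧ π x' ∈ D.support}, strictTransformIdeal π C D.1 = D'.1 := by
      rintro ⟨D', hD'E, hx'⟩
      rcases mem_transform_boundary_cases hD'E hx' with h | ⟨D, hDE, hxD, hD⟩
      · exfalso
        apply hxC
        have : x' ∈ (C.comap π).support := h ▸ hx'
        rwa [Scheme.IdealSheafData.support_comap] at this
      · exact ⟨⟨D, hDE, hxD⟩, hD⟩
    choose g hg using key
    refine ⟨fun D' => ι (g D'), ?_, ?_⟩
    · intro D₁ D₂ heq
      have h2 : g D₁ = g D₂ := hι heq
      apply Subtype.ext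
      rw [← hg D₁, ← hg D₂, h2]
    · intro D'
      rw [← hg D', stalkIdeal_strictTransformIdeal_of_not_mem_support C (g D').1 hxC, ← he,
        hιD (g D'), Ideal.map_span, Set.image_singleton]
      rfl
  · -- the second centre
    intro hx'
    rw [Scheme.IdealSheafData.support_comap] at hx'
    obtain ⟨S, hS⟩ := hC hx'
    refine ⟨S, ?_⟩
    rw [stalkIdeal_comap_eq_map, ← he, hS, Ideal.map_span, Set.image_image]
    rfl

/-! ## §3 Corollaries -/

/-- **Both cases, centre-free conclusion**: `SNCWithAt E C (π x')` ⇒ the transformed family has simple normal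
crossings at `x'`. [cite: Kollar2007, Def. 3.25] -/
theorem _root_.Literature.AlgebraicGeometry.Resolution.IsBlowup.sncWithAt_transform [IsLocallyNoetherian X]
    {X' : Scheme.{u}} {π : X' ⟶ X} {C : X.IdealSheafData} (hπ : IsBlowup π C) {E : List X.IdealSheafData}
    (x' : X') (hE : SNCWithAt E C (π x')) :
    SNCWithAt (E.map (strictTransformIdeal π C) ++ [C.comap π]) ⊤ x' := by
  haveI : IsProper π := hπ.isProper
  haveI : IsLocallyNoetherian X' := LocallyOfFiniteType.isLocallyNoetherian π
  by_cases hxC : π x' ∈ C.support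
  · exact hπ.sncWithAt_transform_of_mem_support x' hE hxC
  · exact (hπ.sncWithAt_transform_of_not_mem_support x' (hE.of_not_mem_support hxC).top hxC).top

/-- The tree's global theorem `HasSNCWith.hasSNC_transform`, re-derived pointwise (sanity check of the API).
[cite: Kollar2007, Def. 3.25] -/
theorem hasSNC_transform_of_forall_sncWithAt [IsLocallyNoetherian X] {X' : Scheme.{u}} {π : X' ⟶ X}
    {C : X.IdealSheafData} (hπ : IsBlowup π C) {E : List X.IdealSheafData} (hE : ∀ x, SNCWithAt E C x) :
    HasSNC (E.map (strictTransformIdeal π C) ++ [C.comap π]) :=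
  hasSNCWith_of_forall_sncWithAt fun x' => hπ.sncWithAt_transform x' (hE (π x'))

/-- **Over a set**: if `E` has simple normal crossings with `C` at every point of a set `W ⊆ X`, then the
transformed family has simple normal crossings at every point of `π⁻¹ W`. (The POCKET form: `W` a neighbourhood
of the deficient centre inside the retract-open.) [cite: Kollar2007, Def. 3.25] -/
theorem _root_.Literature.AlgebraicGeometry.Resolution.IsBlowup.sncWithAt_transform_of_mem_preimage
    [IsLocallyNoetherian X] {X' : Scheme.{u}} {π : X' ⟶ X} {C : X.IdealSheafData} (hπ : IsBlowup π C)
    {E : List X.IdealSheafData} {W : Set X} (hE : ∀ x ∈ W, SNCWithAt E C x) {x' : X'}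
    (hx' : π x' ∈ W) : SNCWithAt (E.map (strictTransformIdeal π C) ++ [C.comap π]) ⊤ x' :=
  hπ.sncWithAt_transform x' (hE _ hx')

/-- **FROZEN POINTS**: at a point `x'` off the centre, simple normal crossings of `E` at `π x'` (with any second
centre `C₂`) persist for the transformed family with `π^*C₂` — the form used along all LATER blow-ups of the
X-side tower, whose centres lie in the strict transforms of `E` and never meet the pockets.
[cite: Kollar2007, Def. 3.25] [cite: StacksProject, Tag 02OS] -/
theorem _root_.Literature.AlgebraicGeometry.Resolution.IsBlowup.sncWithAt_transform_of_disjoint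
    [IsLocallyNoetherian X] {X' : Scheme.{u}} {π : X' ⟶ X} {C : X.IdealSheafData} (hπ : IsBlowup π C)
    {E : List X.IdealSheafData} {C₂ : X.IdealSheafData} {W : Set X}
    (hW : Disjoint W (C.support : Set X)) (hE : ∀ x ∈ W, SNCWithAt E C₂ x) {x' : X'} (hx' : π x' ∈ W) :
    SNCWithAt (E.map (strictTransformIdeal π C) ++ [C.comap π]) (C₂.comap π) x' := by
  haveI : IsProper π := hπ.isProper
  haveI : IsLocallyNoetherian X' := LocallyOfFiniteType.isLocallyNoetherian π
  exact hπ.sncWithAt_transform_of_not_mem_support x' (hE _ hx') (Set.disjoint_left.mp hW hx')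

end DepthSNC

end Summit.ResolutionOfSingularities.ResolutionOfSingularities.Theorems

end
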